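import Literature.NumberTheory.Sieve.FriedlanderIwaniecPrimesRootSpacing
import Literature.NumberTheory.Sieve.RamanujanSum
import HarnessLib

/-!
# Friedlander–Iwaniec, *The polynomial `X² + Y⁴` captures its primes*, §3: the Weyl harmonics `ρ(k, ℓ; d)` and the reduction (3.9)

Family `parity`, statement parity.S17. Source: J. Friedlander, H. Iwaniec, Ann. of Math. (2) 148
(1998), 945–1040 [FriedlanderIwaniecAnnals1998] (= arXiv:math/9811185), §3, (3.7)–(3.9)
(p. 956 of the journal = p. 11 of the arXiv version).

FI Lemma 3.3 (general linear forms in the "Weyl harmonics"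
(3.7) `ρ(k, ℓ; d) = ∑_{ν mod d, ν² + ℓ² ≡ 0 (mod d)} e(νk/d)`
for the equidistribution of the roots of (3.8) `ν² + ℓ² ≡ 0 (mod d)`) is deduced from (3.6)
(= `sum_roots_norm_le` of `FriedlanderIwaniecPrimesRootSpacing`, PROVED) through the reduction
to `ℓ = 1`: "letting `(d, ℓ²) = γδ²` with `γ` squarefree so `d = γδ²d'`, `ℓ = γδℓ'`, one shows that
(3.9) `ρ(k, ℓ; d) = δ ρ(k'ℓ', 1; d')` provided that `k = δk'` is a multiple of `δ`, while `ρ(k, ℓ; d)`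
vanishes if `k` is not divisible by `δ`." This file fixes the definitions and PROVES (3.9) together
with the characterisation of the factorisation `(d, ℓ²) = γδ²` that the proof of Lemma 3.3 sums
over; Lemma 3.3 itself is the subject of the sequel `FriedlanderIwaniecPrimesLemma33`.

## Contents

* `fiRoots ℓ d = {ν mod d : ν² + ℓ² ≡ 0}` (as a subset of `range d`; `fiRoots 1 d` is the root set
  `{ν : d ∣ ν² + 1}` of `FriedlanderIwaniecPrimesRootSpacing`, `fiRoots_one`, of cardinality
  `fiRho d`, `card_fiRoots_one`), `fiWeyl k ℓ d = ρ(k, ℓ; d)` ((3.7); `fiWeyl_zero_left`: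
  `ρ(0, ℓ; d) = ρ(ℓ; d)`; `norm_fiWeyl_le`);
* `dvd_of_squarefree_of_mul_sq_dvd_sq`: `γ` squarefree, `γδ² ∣ n²` ⟹ `γδ ∣ n`;
* `gcd_eq_mul_sq_iff` (the factorisation FI sum over): for `γ` squarefree and `d = γδ²d'`,
  `(d, ℓ²) = γδ²` iff `ℓ = γδℓ'` with `(d', γℓ') = 1`;
* `fiRoots_eq_image`: for such `d, ℓ` the roots of `ν² + ℓ² ≡ 0 (mod d)` are `ν = γδμ`,
  `μ mod δd'`, `μ² + ℓ'² ≡ 0 (mod d')`;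
* `sum_range_mul_eq_sum_sum` (splitting `μ mod δd'` as `μ₀ + d'j`), `sum_fiRoots_twist` (for
  `(d', ℓ') = 1`, `μ₀ ↦ ℓ'ω` matches the roots of `ω² + 1` with those of `μ₀² + ℓ'²`, Mathlib
  `ZMod.unitOfCoprime`), and the orthogonality `∑_{j mod δ} e(jk/δ) = δ·[δ ∣ k]`
  (`RamanujanSum.sum_range_fourierChar_div`);
* **`fiWeyl_eq_of_factorization`** (FI (3.9), PROVED):
  `ρ(k, γδℓ'; γδ²d') = δ ρ((k/δ)ℓ', 1; d')` if `δ ∣ k`, and `= 0` otherwise.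

## References

* J. Friedlander, H. Iwaniec, *The polynomial `X² + Y⁴` captures its primes*, Ann. of Math. (2)
  148 (1998), 945–1040, §3, (3.7)–(3.9). [cite: FriedlanderIwaniecAnnals1998, §3 (3.7)-(3.9)]

## Mathlib / tree search

Tree: `LargeSieve.e` with `e_add`, `e_add_int` (`LargeSieveInequality`), `fiRho`
(`FriedlanderIwaniecPrimes`), `sum_roots_norm_le` (`FriedlanderIwaniecPrimesRootSpacing`, the
consumer of `fiRoots 1 d`), `RamanujanSum.sum_range_fourierChar_div` (`RamanujanSum`). Mathlib:
`Squarefree.dvd_pow_iff_dvd`, `Nat.pow_dvd_pow_iff`, `Nat.gcd_mul_left`, `ZMod.unitOfCoprime`,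
`ZMod.coe_unitOfCoprime`, `ZMod.natCast_eq_zero_iff`, `ZMod.val_cast_of_lt`, `Finset.sum_nbij'`,
`Finset.sum_range_add`. `lean search 'fiWeyl|Weyl harmonic|rho.*k.*l.*d'`: nothing in the tree.
-/

noncomputable section

open Finset Real Complex
open scoped FourierTransform

namespace Literature.NumberTheory.Sieve.FriedlanderIwaniecPrimes

open LargeSieve

/-! ### The roots of `ν² + ℓ² ≡ 0 (mod d)` and the Weyl harmonics -/

/-- The roots of FI (3.8): `{ν mod d : ν² + ℓ² ≡ 0 (mod d)}`, as the subset of `{0, …, d-1}`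
(empty for `d = 0`). For `ℓ = 1` this is the root set of `FriedlanderIwaniecPrimesRootSpacing`
(`fiRoots_one`). [cite: FriedlanderIwaniecAnnals1998, §3 (3.8)] -/
def fiRoots (ℓ d : ℕ) : Finset ℕ := (range d).filter fun ν => d ∣ ν ^ 2 + ℓ ^ 2

/-- Membership in `fiRoots`. [cite: FriedlanderIwaniecAnnals1998, §3 (3.8)] -/
theorem mem_fiRoots {ℓ d ν : ℕ} : ν ∈ fiRoots ℓ d ↔ ν < d ∧ d ∣ ν ^ 2 + ℓ ^ 2 := by
  simp [fiRoots]

/-- `fiRoots 1 d` is the root set `{ν < d : d ∣ ν² + 1}` of `ν² + 1 ≡ 0 (mod d)`.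
[cite: FriedlanderIwaniecAnnals1998, §3, roots of ν² + 1 ≡ 0 (mod d)] -/
theorem fiRoots_one (d : ℕ) : fiRoots 1 d = (range d).filter fun ν => d ∣ ν ^ 2 + 1 := by
  simp [fiRoots]

/-- `#fiRoots 1 d = ρ(d)` (`fiRho`). [cite: FriedlanderIwaniecAnnals1998, §3, ρ(d)] -/
theorem card_fiRoots_one (d : ℕ) : #(fiRoots 1 d) = fiRho d := by
  rw [fiRoots_one, fiRho]

/-- `#fiRoots ℓ d ≤ d`. [folklore] -/
theorem card_fiRoots_le (ℓ d : ℕ) : #(fiRoots ℓ d) ≤ d :=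
  (card_filter_le _ _).trans (card_range d).le

/-- **FI (3.7)**, the "Weyl harmonics" for the equidistribution of the roots of (3.8):
`ρ(k, ℓ; d) = ∑_{ν mod d, ν² + ℓ² ≡ 0 (mod d)} e(νk/d)` (`e(t) = exp(2πit)`), for natural `k`.
[cite: FriedlanderIwaniecAnnals1998, §3 (3.7)] -/
def fiWeyl (k ℓ d : ℕ) : ℂ := ∑ ν ∈ fiRoots ℓ d, e ((ν : ℝ) * k / d)

/-- `fiWeyl` unfolded. [cite: FriedlanderIwaniecAnnals1998, §3 (3.7)] -/
theorem fiWeyl_def (k ℓ d : ℕ) : fiWeyl k ℓ d = ∑ ν ∈ fiRoots ℓ d, e ((ν : ℝ) * k / d) := rfl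

/-- `ρ(0, ℓ; d) = ρ(ℓ; d)` is the number of roots ("`ρ(0, ℓ; d) = ρ(ℓ; d)` is the multiplicative
function which appears in the expected main term"). [cite: FriedlanderIwaniecAnnals1998, §3, after (3.8)] -/
theorem fiWeyl_zero_left (ℓ d : ℕ) : fiWeyl 0 ℓ d = #(fiRoots ℓ d) := by
  rw [fiWeyl, card_eq_sum_ones, Nat.cast_sum]
  refine sum_congr rfl fun ν _ => ?_
  rw [Nat.cast_zero, mul_zero, zero_div, e_zero, Nat.cast_one]

/-- The trivial bound `|ρ(k, ℓ; d)| ≤ ρ(ℓ; d) = #fiRoots ℓ d`. [folklore] -/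
theorem norm_fiWeyl_le (k ℓ d : ℕ) : ‖fiWeyl k ℓ d‖ ≤ #(fiRoots ℓ d) := by
  rw [fiWeyl, card_eq_sum_ones, Nat.cast_sum]
  refine (norm_sum_le _ _).trans (sum_le_sum fun ν _ => ?_)
  rw [norm_e, Nat.cast_one]

/-- `ρ(m, 1; d)` written over the root set of `ν² + 1`. [cite: FriedlanderIwaniecAnnals1998, §3 (3.7) with ℓ = 1] -/
theorem fiWeyl_one (m d : ℕ) :
    fiWeyl m 1 d = ∑ ν ∈ (range d).filter (fun ν => d ∣ ν ^ 2 + 1), e ((ν : ℝ) * m / d) := by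
  rw [fiWeyl, fiRoots_one]

/-! ### The factorisation `(d, ℓ²) = γδ²` -/

/-- If `γ` is squarefree and `γδ² ∣ n²` then `γδ ∣ n`. [folklore] -/
theorem dvd_of_squarefree_of_mul_sq_dvd_sq {γ δ n : ℕ} (hγ : Squarefree γ)
    (h : γ * δ ^ 2 ∣ n ^ 2) : γ * δ ∣ n := by
  have hδn : δ ∣ n := by
    have : δ ^ 2 ∣ n ^ 2 := (Dvd.intro_left γ rfl).trans h
    exact (Nat.pow_dvd_pow_iff two_ne_zero).mp this
  obtain ⟨m, rfl⟩ := hδn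
  rcases Nat.eq_zero_or_pos δ with rfl | hδ0
  · simp
  · have hγm : γ ∣ m ^ 2 := by
      have h' : δ ^ 2 * γ ∣ δ ^ 2 * m ^ 2 := by
        rw [mul_comm (δ ^ 2) γ, ← mul_pow]
        exact h
      exact Nat.dvd_of_mul_dvd_mul_left (pow_pos hδ0 2) h'
    rw [mul_comm γ δ]
    exact Nat.mul_dvd_mul_left δ ((hγ.dvd_pow_iff_dvd two_ne_zero).mp hγm)

/-- **The factorisation summed over in the proof of Lemma 3.3.** For `γ` squarefree, `δ, d' ≥ 1`
and `d = γδ²d'`: `(d, ℓ²) = γδ²` if and only if `ℓ = γδℓ'` with `(d', γℓ') = 1`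
(FI: "letting `(d, ℓ²) = γδ²` with `γ` squarefree so `d = γδ²d'`, `ℓ = γδℓ'` … `(ℓ, d) = 1`").
[cite: FriedlanderIwaniecAnnals1998, §3, proof of Lemma 3.3] -/
theorem gcd_eq_mul_sq_iff {γ δ d' ℓ : ℕ} (hγ : Squarefree γ) (hγ0 : 0 < γ) (hδ : 0 < δ) :
    Nat.gcd (γ * δ ^ 2 * d') (ℓ ^ 2) = γ * δ ^ 2 ↔
      γ * δ ∣ ℓ ∧ Nat.Coprime d' (γ * (ℓ / (γ * δ))) := by
  have hγδ0 : 0 < γ * δ := Nat.mul_pos hγ0 hδ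
  have hsq : ∀ ℓ' : ℕ, (γ * δ * ℓ') ^ 2 = γ * δ ^ 2 * (γ * ℓ' ^ 2) := fun ℓ' => by ring
  constructor
  · intro h
    have hdvd : γ * δ ^ 2 ∣ ℓ ^ 2 := h ▸ Nat.gcd_dvd_right _ _
    have hγδ : γ * δ ∣ ℓ := dvd_of_squarefree_of_mul_sq_dvd_sq hγ hdvd
    refine ⟨hγδ, ?_⟩
    obtain ⟨ℓ', rfl⟩ := hγδ
    rw [Nat.mul_div_cancel_left _ hγδ0]
    rw [hsq, Nat.gcd_mul_left] at h
    have h1 : Nat.gcd d' (γ * ℓ' ^ 2) = 1 := (mul_eq_left₀ (by positivity)).mp h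
    exact Nat.Coprime.coprime_dvd_right ⟨ℓ', by ring⟩ h1
  · rintro ⟨hγδ, hcop⟩
    obtain ⟨ℓ', rfl⟩ := hγδ
    rw [Nat.mul_div_cancel_left _ hγδ0] at hcop
    rw [hsq, Nat.gcd_mul_left]
    have h2 : Nat.Coprime d' (γ * ℓ' ^ 2) := by
      rw [show γ * ℓ' ^ 2 = γ * ℓ' * ℓ' by ring]
      exact Nat.Coprime.mul_right hcop (Nat.Coprime.coprime_dvd_right ⟨γ, by ring⟩ hcop)
    rw [Nat.Coprime.gcd_eq_one h2, mul_one]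

/-! ### The roots for `d = γδ²d'`, `ℓ = γδℓ'` -/

/-- **The roots of `ν² + ℓ² ≡ 0 (mod d)` for `d = γδ²d'`, `ℓ = γδℓ'`** (`γ` squarefree,
`(d', γ) = 1`): they are exactly `ν = γδμ` with `μ mod δd'` and `μ² + ℓ'² ≡ 0 (mod d')`
(from `d ∣ ν² + ℓ²`: `γδ² ∣ ν²`, so `γδ ∣ ν`; then `γδ²d' ∣ γδ²·γ(μ² + ℓ'²)` iff `d' ∣ μ² + ℓ'²`).
[cite: FriedlanderIwaniecAnnals1998, §3, proof of (3.9)] -/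
theorem fiRoots_eq_image {γ δ d' ℓ' : ℕ} (hγ : Squarefree γ) (hγ0 : 0 < γ) (hδ : 0 < δ)
    (hcopγ : Nat.Coprime d' γ) :
    fiRoots (γ * δ * ℓ') (γ * δ ^ 2 * d') =
      ((range (δ * d')).filter fun μ => d' ∣ μ ^ 2 + ℓ' ^ 2).image fun μ => γ * δ * μ := by
  have hγδ0 : 0 < γ * δ := Nat.mul_pos hγ0 hδ
  have hfac : ∀ μ : ℕ, (γ * δ * μ) ^ 2 + (γ * δ * ℓ') ^ 2 = γ * δ ^ 2 * (γ * (μ ^ 2 + ℓ' ^ 2)) :=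
    fun μ => by ring
  have hd : γ * δ ^ 2 * d' = γ * δ * (δ * d') := by ring
  ext ν
  simp only [mem_fiRoots, mem_image, mem_filter, mem_range]
  constructor
  · rintro ⟨hν, hdvd⟩
    -- `γδ² ∣ ν²`, hence `γδ ∣ ν`
    have h1 : γ * δ ^ 2 ∣ ν ^ 2 + (γ * δ * ℓ') ^ 2 := (Dvd.intro _ rfl).trans hdvd
    have h2 : γ * δ ^ 2 ∣ (γ * δ * ℓ') ^ 2 := ⟨γ * ℓ' ^ 2, by ring⟩
    have h3 : γ * δ ^ 2 ∣ ν ^ 2 := (Nat.dvd_add_left h2).mp h1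
    obtain ⟨μ, rfl⟩ := dvd_of_squarefree_of_mul_sq_dvd_sq hγ h3
    refine ⟨μ, ⟨?_, ?_⟩, rfl⟩
    · rw [hd] at hν
      exact Nat.lt_of_mul_lt_mul_left hν
    · rw [hfac] at hdvd
      have h4 : d' ∣ γ * (μ ^ 2 + ℓ' ^ 2) := Nat.dvd_of_mul_dvd_mul_left (by positivity) hdvd
      exact hcopγ.dvd_of_dvd_mul_left h4
  · rintro ⟨μ, ⟨hμ, hdvd⟩, rfl⟩
    refine ⟨?_, ?_⟩
    · rw [hd]
      exact Nat.mul_lt_mul_of_pos_left hμ hγδ0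
    · rw [hfac]
      exact Nat.mul_dvd_mul_left _ (hdvd.mul_left γ)

/-! ### Splitting `μ mod δd'` and twisting by `ℓ'` -/

/-- Splitting a sum over `μ < ab` as `μ = i + aj`, `i < a`, `j < b`. [folklore] -/
theorem sum_range_mul_eq_sum_sum {M : Type*} [AddCommMonoid M] (f : ℕ → M) (a b : ℕ) :
    ∑ μ ∈ range (a * b), f μ = ∑ j ∈ range b, ∑ i ∈ range a, f (i + a * j) := by
  induction b with
  | zero => simp
  | succ b ih =>
      rw [Nat.mul_succ, sum_range_add, ih, sum_range_succ]
      congr 1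
      exact sum_congr rfl fun i _ => by rw [add_comm]

/-- **Twisting by a unit.** For `(d', ℓ') = 1` the map `ω ↦ ℓ'ω` matches the roots of
`ω² + 1 ≡ 0` with those of `μ² + ℓ'² ≡ 0 (mod d')`, so that
`∑_{μ² + ℓ'² ≡ 0 (d')} e(μm/d') = ∑_{ω² + 1 ≡ 0 (d')} e(ω m ℓ'/d')` ("if `k ≠ 0` then `ρ(k, ℓ; d)` is
more involved but one can at least reduce this to the case `ℓ = 1`").
[cite: FriedlanderIwaniecAnnals1998, §3, proof of (3.9)] -/
theorem sum_fiRoots_twist {d' ℓ' : ℕ} (hd' : 0 < d') (hcop : Nat.Coprime d' ℓ') (m : ℕ) :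
    ∑ μ ∈ fiRoots ℓ' d', e ((μ : ℝ) * m / d') =
      ∑ ω ∈ fiRoots 1 d', e ((ω : ℝ) * (m * ℓ') / d') := by
  haveI : NeZero d' := ⟨hd'.ne'⟩
  set u : (ZMod d')ˣ := ZMod.unitOfCoprime ℓ' hcop.symm with hu
  have hucoe : (u : ZMod d') = (ℓ' : ZMod d') := ZMod.coe_unitOfCoprime ℓ' hcop.symm
  have huinv : ((u⁻¹ : (ZMod d')ˣ) : ZMod d') * (ℓ' : ZMod d') = 1 := by
    rw [← hucoe, Units.inv_mul]
  -- the maps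
  symm
  refine Finset.sum_nbij' (fun ω => (((ℓ' * ω : ℕ) : ZMod d')).val)
    (fun μ => (((u⁻¹ : (ZMod d')ˣ) : ZMod d') * (μ : ZMod d')).val) ?_ ?_ ?_ ?_ ?_
  · -- roots of `ω² + 1` go to roots of `μ² + ℓ'²`
    intro ω hω
    rw [mem_fiRoots] at hω ⊢
    refine ⟨ZMod.val_lt _, ?_⟩
    rw [← ZMod.natCast_eq_zero_iff]
    have h0 : ((ω ^ 2 + 1 ^ 2 : ℕ) : ZMod d') = 0 := (ZMod.natCast_eq_zero_iff _ _).mpr hω.2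
    push_cast at h0 ⊢
    rw [ZMod.natCast_zmod_val]
    linear_combination (ℓ' : ZMod d') ^ 2 * h0
  · -- and back
    intro μ hμ
    rw [mem_fiRoots] at hμ ⊢
    refine ⟨ZMod.val_lt _, ?_⟩
    rw [← ZMod.natCast_eq_zero_iff]
    have h0 : ((μ ^ 2 + ℓ' ^ 2 : ℕ) : ZMod d') = 0 := (ZMod.natCast_eq_zero_iff _ _).mpr hμ.2
    push_cast at h0 ⊢
    rw [ZMod.natCast_zmod_val]
    linear_combination ((u⁻¹ : (ZMod d')ˣ) : ZMod d') ^ 2 * h0 -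
      (((u⁻¹ : (ZMod d')ˣ) : ZMod d') * (ℓ' : ZMod d') + 1) * huinv
  · -- left inverse
    intro ω hω
    rw [mem_fiRoots] at hω
    rw [ZMod.natCast_zmod_val, Nat.cast_mul, ← mul_assoc, huinv, one_mul, ZMod.val_cast_of_lt hω.1]
  · -- right inverse
    intro μ hμ
    rw [mem_fiRoots] at hμ
    rw [Nat.cast_mul, ZMod.natCast_zmod_val, ← mul_assoc, mul_comm (ℓ' : ZMod d'), huinv, one_mul,
      ZMod.val_cast_of_lt hμ.1]
  · -- the phases agree: `(ℓ'ω mod d') m / d' ≡ ℓ' ω m / d' (mod 1)`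
    intro ω _
    rw [ZMod.val_natCast]
    have hdiv := Nat.div_add_mod (ℓ' * ω) d'
    set q := ℓ' * ω / d' with hq
    set r := ℓ' * ω % d' with hr
    have hr' : (r : ℝ) = (ℓ' : ℝ) * ω - (d' : ℝ) * q := by
      have : ((d' * q + r : ℕ) : ℝ) = ((ℓ' * ω : ℕ) : ℝ) := by rw [hdiv]
      push_cast at this
      linarith
    have hd'0 : (d' : ℝ) ≠ 0 := by exact_mod_cast hd'.ne'
    have : (r : ℝ) * m / d' = (ω : ℝ) * (m * ℓ') / d' + ((-(q * m : ℕ) : ℤ) : ℝ) := by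
      rw [hr']
      push_cast
      field_simp
      ring
    rw [this, e_add_int]

/-! ### FI (3.9) -/

/-- **FI (3.9), PROVED.** For `γ` squarefree, `δ, d' ≥ 1`, `(d', γ) = (d', ℓ') = 1`, and
`d = γδ²d'`, `ℓ = γδℓ'` (the factorisation `(d, ℓ²) = γδ²` of `gcd_eq_mul_sq_iff`):
`ρ(k, ℓ; d) = δ ρ(k'ℓ', 1; d')` if `k = δk'`, and `ρ(k, ℓ; d) = 0` if `δ ∤ k`.
Proof as in FI: the roots are `ν = γδμ`, `μ = μ₀ + d'j` (`μ₀ mod d'` a root of `μ₀² + ℓ'²`,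
`j mod δ`) (`fiRoots_eq_image`, `sum_range_mul_eq_sum_sum`), `e(νk/d) = e(μ₀k/(δd')) e(jk/δ)`,
the sum over `j` is `δ·[δ ∣ k]` (`RamanujanSum.sum_range_fourierChar_div`), and for `k = δk'`,
`μ₀ = ℓ'ω` turns `e(μ₀k'/d')` into `e(ωk'ℓ'/d')` over the roots of `ω² + 1` (`sum_fiRoots_twist`).
[cite: FriedlanderIwaniecAnnals1998, §3 (3.9)] -/
theorem fiWeyl_eq_of_factorization {γ δ d' ℓ' : ℕ} (hγ : Squarefree γ) (hγ0 : 0 < γ) (hδ : 0 < δ)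
    (hd' : 0 < d') (hcopγ : Nat.Coprime d' γ) (hcopℓ : Nat.Coprime d' ℓ') (k : ℕ) :
    fiWeyl k (γ * δ * ℓ') (γ * δ ^ 2 * d') =
      if δ ∣ k then (δ : ℂ) * fiWeyl (k / δ * ℓ') 1 d' else 0 := by
  have hγδ0 : 0 < γ * δ := Nat.mul_pos hγ0 hδ
  have hγr : (γ : ℝ) ≠ 0 := by exact_mod_cast hγ0.ne'
  have hδr : (δ : ℝ) ≠ 0 := by exact_mod_cast hδ.ne'
  have hd'r : (d' : ℝ) ≠ 0 := by exact_mod_cast hd'.ne'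
  -- Step 1: the roots are `γδμ`, `μ mod δd'` with `d' ∣ μ² + ℓ'²`
  rw [fiWeyl, fiRoots_eq_image hγ hγ0 hδ hcopγ,
    sum_image fun μ₁ _ μ₂ _ h => Nat.eq_of_mul_eq_mul_left hγδ0 h]
  have hphase : ∀ μ : ℕ, e (((γ * δ * μ : ℕ) : ℝ) * k / ((γ * δ ^ 2 * d' : ℕ) : ℝ)) =
      e ((μ : ℝ) * k / ((δ : ℝ) * d')) := by
    intro μ
    congr 1
    push_cast
    field_simp
  simp_rw [hphase]
  -- Step 2: indicator form, and the splitting `μ = i + d' j`, `i < d'`, `j < δ`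
  rw [sum_filter, mul_comm δ d', sum_range_mul_eq_sum_sum]
  have hind : ∀ i j : ℕ, (d' ∣ (i + d' * j) ^ 2 + ℓ' ^ 2 ↔ d' ∣ i ^ 2 + ℓ' ^ 2) := by
    intro i j
    rw [show (i + d' * j) ^ 2 + ℓ' ^ 2 = i ^ 2 + ℓ' ^ 2 + d' * (2 * i * j + d' * j ^ 2) by ring]
    exact Nat.dvd_add_left (dvd_mul_right d' _)
  have hsplit : ∀ i j : ℕ, e (((i + d' * j : ℕ) : ℝ) * k / ((δ : ℝ) * d')) =
      e ((i : ℝ) * k / ((δ : ℝ) * d')) * e ((j : ℝ) * k / δ) := by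
    intro i j
    rw [← e_add]
    congr 1
    push_cast
    field_simp
  have hterm : ∀ i j : ℕ,
      (if d' ∣ (i + d' * j) ^ 2 + ℓ' ^ 2 then e (((i + d' * j : ℕ) : ℝ) * k / ((δ : ℝ) * d'))
        else 0) =
      (if d' ∣ i ^ 2 + ℓ' ^ 2 then e ((i : ℝ) * k / ((δ : ℝ) * d')) else 0) *
        e ((j : ℝ) * k / δ) := by
    intro i j
    rw [if_congr (hind i j) (hsplit i j) rfl]
    split_ifs <;> simp
  simp_rw [hterm, ← sum_mul, ← mul_sum]
  -- Step 3: orthogonality in `j`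
  have horth : ∑ j ∈ range δ, e ((j : ℝ) * k / δ) = if δ ∣ k then (δ : ℂ) else 0 := by
    have h := RamanujanSum.sum_range_fourierChar_div hδ.ne' (k : ℤ)
    push_cast at h
    rw [h]
    exact if_congr Int.natCast_dvd_natCast rfl rfl
  rw [horth]
  split_ifs with hdk
  · -- Step 4: `k = δk'`, and the twist `μ₀ = ℓ'ω`
    obtain ⟨k', rfl⟩ := hdk
    rw [Nat.mul_div_cancel_left k' hδ, mul_comm _ (δ : ℂ)]
    congr 1
    rw [← sum_filter, fiWeyl]
    have hphase' : ∀ i : ℕ, e ((i : ℝ) * ((δ * k' : ℕ) : ℝ) / ((δ : ℝ) * d')) =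
        e ((i : ℝ) * k' / d') := by
      intro i
      congr 1
      push_cast
      field_simp
    simp_rw [hphase']
    rw [show (range d').filter (fun i => d' ∣ i ^ 2 + ℓ' ^ 2) = fiRoots ℓ' d' from rfl,
      sum_fiRoots_twist hd' hcopℓ k']
    refine sum_congr rfl fun ω _ => ?_
    push_cast
    ring_nf
  · simp

end Literature.NumberTheory.Sieve.FriedlanderIwaniecPrimes
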